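import Summits.BirchSwinnertonDyer.BirchSwinnertonDyer.Theorems.PrintCFramBottomClassIndexLawFiveLeHerbrandEigenspaceProjectors
import Mathlib.RepresentationTheory.Coinduced
import HarnessLib

/-!
# Route `PrintCFram`, crux C2 `BottomClassIndexLawFiveLe` (stmt-BirchSwinnertonDyer-20372), line
# `eisenstein-resource-bdp-line` v10, Stub H `stub_bottomResidualSelmer_trivial_of_bernoulliPair`, typing item T3 of
# `Lines/herbrand-regular-locus-M1-anatomy.md` §8, part 3: FROBENIUS RECIPROCITY FOR `χ`-PARTS — the `χ`-part of a
# coinduced (= induced, finite index) module `Coind_G^H A` is the `χ|_G`-part of `A`; permutation modules and modules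
# with scalar action (anatomy §4 (i)(ii)(iii), §5)
# (cell `bsd-print-cfram`, seat `bsd-line-cfram-p1-w4` g4; helper `--supports` 20372; 0 facts, 0 defs)

HONEST FRAMING. Nothing about BSD is proved here. Pure algebra continuing `…HerbrandEigenspaceProjectors`, in
Mathlib's currency `Representation.coind φ σ` (for `φ : G →* H` and `σ : Representation k G A`: the `H`-module of
functions `f : H → A` with `f (φ g · h) = σ g (f h)`, `H` acting by right translation — for `G ≤ H` of finite index this
is the induced module `ℤ[H] ⊗_{ℤ[G]} A`; the semi-local units `∏_{w ∣ v} U_w`, the permutation module `ℤ[{w ∣ 𝔭}]`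
and `∏_{w ∣ v} μ(L_w)` of the herbrand anatomy §4 are of this shape with `G = Δ_v ≤ H = Δ`). For a character
`χ : H →* kˣ`:
* `coe_apply_eq_of_mem` — a `χ`-eigenvector `f ∈ (Coind A)^{(χ)}` is `h ↦ χ(h) • f(1)` (`mem_iInf_eigenspace_coind_iff`);
* `apply_one_mem_iInf_eigenspace` — `f(1) ∈ A^{(χ ∘ φ)}`; `eq_zero_of_apply_one_eq_zero` — `f ↦ f(1)` is injective on
  `(Coind A)^{(χ)}`; `exists_mem_iInf_eigenspace_coind_apply_one_eq` — and onto `A^{(χ∘φ)}`: **FROBENIUS RECIPROCITY**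
  `(Coind_G^H A)^{(χ)} ≅ A^{(χ|_G)}` (as the two statements `map_eval_one_iInf_eigenspace_coind_eq` +
  injectivity; no finiteness, no index hypothesis), whence **`iInf_eigenspace_coind_eq_bot_iff`**:
  `(Coind A)^{(χ)} = 0 ↔ A^{(χ∘φ)} = 0`;
* scalar actions: if `G` acts on `A` through a character `η` (`σ g a = η(g) a`), then `A^{(ψ)} = 0` as soon as
  `η(g) − ψ(g)` is a unit for one `g` (`iInf_eigenspace_eq_bot_of_scalar_of_isUnit`; the Teichmüller case: distinct
  `(p−1)`-th roots of unity differ by `p`-units), and over a domain `A^{(ψ)} = 0` for `A` torsion-free unless `ψ = η`;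
  the trivial module `k`: `k^{(ψ)} = 0 ↔ ψ ≠ 1` (`iInf_eigenspace_trivial_eq_bot_iff`, domain). Hence the PERMUTATION
  MODULE `k[H/G] = Coind_G^H k`: **`iInf_eigenspace_coind_trivial_eq_bot_iff`** `(k[H/G])^{(χ)} = 0 ↔ χ|_G ≠ 1` — anatomy
  §4 (i) `(Ind_{Δ_𝔭}^Δ 𝟙)^{(θ)} = 0` since `θ|_{Δ_𝔭} ≠ 1`; and `iInf_eigenspace_coind_eq_bot_of_scalar_of_isUnit` — §4 (ii)(iii)
  `(Ind_{Δ_v}^Δ μ)^{(θ)} = 0` since `θ|_{I_v} ≠ ω|_{I_v}`.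

THEOREMS ONLY; no definition, no named fact, no `sorry`; imports no `Theses` module. BSD is not proved by any of
this; no summit statement is proved by this seat.
References: [SerreLinearRepresentations1977] §7.2 (Frobenius reciprocity); [Washington1997] §6.3;
[Lang1990] Ch. 1 §3; [NeukirchSchmidtWingberg2008] I.§6 (induced modules, semi-local theory).
-/

set_option autoImplicit false
-- `…BirchSwinnertonDyer.BirchSwinnertonDyer.Theorems…` is the problem's mandated namespace (D-0017).
set_option linter.dupNamespace false

namespace Summit.BirchSwinnertonDyer.BirchSwinnertonDyer.Theorems.PrintCFram.HerbrandEigenspace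

open Module Module.End Representation

/-! ## `χ`-eigenvectors in a coinduced module -/

section Coind

variable {k G H A : Type*} [CommRing k] [Group G] [Group H] (φ : G →* H) [AddCommGroup A] [Module k A]
  (σ : Representation k G A) (χ : H →* kˣ)

/-- The action of `H` on `Coind A`: `(h • f)(h₁) = f(h₁ h)` (Mathlib `Representation.coind`, unfolded). [folklore] -/
theorem coind_apply_coe_apply (h h₁ : H) (f : coindV φ σ) :
    ((coind φ σ h f : coindV φ σ) : H → A) h₁ = (f : H → A) (h₁ * h) :=
  rfl

/-- **A `χ`-eigenvector of `Coind A` is `h ↦ χ(h) • f(1)`**: membership in `(Coind A)^{(χ)}`. [folklore] -/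
theorem mem_iInf_eigenspace_coind_iff (f : coindV φ σ) :
    f ∈ ⨅ h : H, eigenspace (coind φ σ h) (χ h : k) ↔ ∀ h : H, (f : H → A) h = (χ h : k) • (f : H → A) 1 := by
  rw [mem_iInf_eigenspace_iff]
  constructor
  · intro hf h
    have e := congrArg (fun u : coindV φ σ => (u : H → A) 1) (hf h)
    simpa only [coind_apply_coe_apply, one_mul, Submodule.coe_smul, Pi.smul_apply] using e
  · intro hf h
    apply Subtype.ext
    funext h₁
    rw [coind_apply_coe_apply, Submodule.coe_smul, Pi.smul_apply, hf (h₁ * h), hf h₁, smul_smul, map_mul,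
      Units.val_mul, mul_comm]

/-- The values of a `χ`-eigenvector: `f(h) = χ(h) • f(1)`. [folklore] -/
theorem coe_apply_eq_of_mem {f : coindV φ σ} (hf : f ∈ ⨅ h : H, eigenspace (coind φ σ h) (χ h : k)) (h : H) :
    (f : H → A) h = (χ h : k) • (f : H → A) 1 :=
  (mem_iInf_eigenspace_coind_iff φ σ χ f).mp hf h

/-- **`f(1) ∈ A^{(χ ∘ φ)}`** for `f ∈ (Coind A)^{(χ)}`: `σ g (f 1) = f (φ g) = χ(φ g) • f 1`. [folklore] -/
theorem apply_one_mem_iInf_eigenspace {f : coindV φ σ} (hf : f ∈ ⨅ h : H, eigenspace (coind φ σ h) (χ h : k)) :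
    (f : H → A) 1 ∈ ⨅ g : G, eigenspace (σ g) ((χ.comp φ) g : k) := by
  rw [mem_iInf_eigenspace_iff]
  intro g
  have e := f.2 g 1
  rw [mul_one] at e
  rw [← e, MonoidHom.comp_apply]
  exact coe_apply_eq_of_mem φ σ χ hf (φ g)

/-- **Injectivity of `f ↦ f(1)` on `(Coind A)^{(χ)}`.** [folklore] -/
theorem eq_zero_of_apply_one_eq_zero {f : coindV φ σ} (hf : f ∈ ⨅ h : H, eigenspace (coind φ σ h) (χ h : k))
    (h0 : (f : H → A) 1 = 0) : f = 0 := by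
  apply Subtype.ext
  funext h
  rw [coe_apply_eq_of_mem φ σ χ hf h, h0, smul_zero]
  rfl

/-- Two `χ`-eigenvectors of `Coind A` with the same value at `1` are equal. [folklore] -/
theorem eq_of_apply_one_eq {f f' : coindV φ σ} (hf : f ∈ ⨅ h : H, eigenspace (coind φ σ h) (χ h : k))
    (hf' : f' ∈ ⨅ h : H, eigenspace (coind φ σ h) (χ h : k)) (h1 : (f : H → A) 1 = (f' : H → A) 1) : f = f' := by
  rw [← sub_eq_zero]
  refine eq_zero_of_apply_one_eq_zero φ σ χ (Submodule.sub_mem _ hf hf') ?_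
  rw [Submodule.coe_sub, Pi.sub_apply, h1, sub_self]

/-- **Surjectivity of `f ↦ f(1)` onto `A^{(χ∘φ)}`**: for `a ∈ A^{(χ∘φ)}` the function `h ↦ χ(h) • a` is a
`χ`-eigenvector of `Coind A` with value `a` at `1`. [folklore] -/
theorem exists_mem_iInf_eigenspace_coind_apply_one_eq {a : A} (ha : a ∈ ⨅ g : G, eigenspace (σ g) ((χ.comp φ) g : k)) :
    ∃ f ∈ ⨅ h : H, eigenspace (coind φ σ h) (χ h : k), (f : H → A) 1 = a := by
  rw [mem_iInf_eigenspace_iff] at ha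
  have hmem : (fun h : H => (χ h : k) • a) ∈ coindV φ σ := by
    rw [mem_coindV]
    intro g h
    simp only [map_smul, ha g, MonoidHom.comp_apply, map_mul, Units.val_mul, smul_smul, mul_comm]
  refine ⟨⟨_, hmem⟩, ?_, ?_⟩
  · rw [mem_iInf_eigenspace_coind_iff]
    intro h
    simp only [map_one, Units.val_one, one_smul]
  · simp only [map_one, Units.val_one, one_smul]

/-- **Frobenius reciprocity, image form**: evaluation at `1` (the linear map `proj 1 ∘ subtype`) maps `(Coind A)^{(χ)}`
ONTO `A^{(χ ∘ φ)}`. [cite: SerreLinearRepresentations1977, §7.2] [folklore] -/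
theorem map_eval_one_iInf_eigenspace_coind_eq :
    (⨅ h : H, eigenspace (coind φ σ h) (χ h : k)).map ((LinearMap.proj (1 : H)).comp (coindV φ σ).subtype) =
      ⨅ g : G, eigenspace (σ g) ((χ.comp φ) g : k) := by
  refine le_antisymm ?_ fun a ha => ?_
  · intro a ha
    obtain ⟨f, hf, rfl⟩ := Submodule.mem_map.mp ha
    exact apply_one_mem_iInf_eigenspace φ σ χ hf
  · obtain ⟨f, hf, hfa⟩ := exists_mem_iInf_eigenspace_coind_apply_one_eq φ σ χ ha
    exact Submodule.mem_map.mpr ⟨f, hf, hfa⟩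

/-- **Frobenius reciprocity, kernel form**: evaluation at `1` is injective on `(Coind A)^{(χ)}`.
[cite: SerreLinearRepresentations1977, §7.2] [folklore] -/
theorem disjoint_iInf_eigenspace_coind_ker_eval_one :
    Disjoint (⨅ h : H, eigenspace (coind φ σ h) (χ h : k))
      (LinearMap.ker ((LinearMap.proj (1 : H)).comp (coindV φ σ).subtype)) := by
  rw [Submodule.disjoint_def]
  intro f hf hf0
  exact eq_zero_of_apply_one_eq_zero φ σ χ hf (LinearMap.mem_ker.mp hf0)

/-- **`(Coind_G^H A)^{(χ)} = 0 ↔ A^{(χ|_G)} = 0`.** [cite: SerreLinearRepresentations1977, §7.2] [folklore] -/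
theorem iInf_eigenspace_coind_eq_bot_iff :
    (⨅ h : H, eigenspace (coind φ σ h) (χ h : k)) = ⊥ ↔ (⨅ g : G, eigenspace (σ g) ((χ.comp φ) g : k)) = ⊥ := by
  constructor
  · intro h
    rw [← map_eval_one_iInf_eigenspace_coind_eq φ σ χ, h, Submodule.map_bot]
  · intro h
    refine (Submodule.eq_bot_iff _).mpr fun f hf => eq_zero_of_apply_one_eq_zero φ σ χ hf ?_
    have := apply_one_mem_iInf_eigenspace φ σ χ hf
    rw [h] at this
    exact (Submodule.mem_bot k).mp this

end Coind

/-! ## Modules with scalar action: `A^{(ψ)}` when `G` acts through a character `η` -/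

section Scalar

variable {k G A : Type*} [CommRing k] [Group G] [AddCommGroup A] [Module k A]
  (σ : Representation k G A) (η ψ : G →* kˣ)

/-- If `G` acts on `A` through `η` then `A^{(η)} = A`. [folklore] -/
theorem iInf_eigenspace_eq_top_of_scalar (hσ : ∀ (g : G) (a : A), σ g a = (η g : k) • a) :
    (⨅ g : G, eigenspace (σ g) (η g : k)) = ⊤ :=
  eq_top_iff.mpr fun a _ => (mem_iInf_eigenspace_iff σ η a).mpr fun g => hσ g a

/-- If `G` acts on `A` through `η` and `η(g₀) − ψ(g₀)` is a UNIT of `k` for some `g₀`, then `A^{(ψ)} = 0` — no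
hypothesis on `A` (torsion allowed; Teichmüller characters: distinct values differ by `p`-adic units).
[cite: Washington1997, §6.3] [folklore] -/
theorem iInf_eigenspace_eq_bot_of_scalar_of_isUnit (hσ : ∀ (g : G) (a : A), σ g a = (η g : k) • a) (g₀ : G)
    (hu : IsUnit ((η g₀ : k) - (ψ g₀ : k))) : (⨅ g : G, eigenspace (σ g) (ψ g : k)) = ⊥ := by
  refine (Submodule.eq_bot_iff _).mpr fun a ha => ?_
  rw [mem_iInf_eigenspace_iff] at ha
  have h0 : ((η g₀ : k) - (ψ g₀ : k)) • a = 0 := by rw [sub_smul, ← hσ g₀ a, ha g₀, sub_self]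
  obtain ⟨u, hu⟩ := hu
  rw [← hu] at h0
  simpa using congrArg (fun b => ((u⁻¹ : kˣ) : k) • b) h0

/-- Over a domain, for `A` torsion-free: if `G` acts on `A` through `η ≠ ψ` then `A^{(ψ)} = 0`. [folklore] -/
theorem iInf_eigenspace_eq_bot_of_scalar_of_ne [IsDomain k] [NoZeroSMulDivisors k A]
    (hσ : ∀ (g : G) (a : A), σ g a = (η g : k) • a) (hne : η ≠ ψ) :
    (⨅ g : G, eigenspace (σ g) (ψ g : k)) = ⊥ := by
  obtain ⟨g₀, hg₀⟩ : ∃ g₀ : G, η g₀ ≠ ψ g₀ := not_forall.mp fun h => hne (MonoidHom.ext h)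
  refine (Submodule.eq_bot_iff _).mpr fun a ha => ?_
  rw [mem_iInf_eigenspace_iff] at ha
  have h0 : ((η g₀ : k) - (ψ g₀ : k)) • a = 0 := by rw [sub_smul, ← hσ g₀ a, ha g₀, sub_self]
  rcases smul_eq_zero.mp h0 with h | h
  · exact absurd (Units.val_injective (sub_eq_zero.mp h)) hg₀
  · exact h

/-- The trivial module `k`: `k^{(ψ)} = 0 ↔ ψ ≠ 1` (`k` a domain). [folklore] -/
theorem iInf_eigenspace_trivial_eq_bot_iff [IsDomain k] :
    (⨅ g : G, eigenspace (Representation.trivial k G k g) (ψ g : k)) = ⊥ ↔ ψ ≠ 1 := by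
  constructor
  · intro h hψ
    subst hψ
    have h1 : (1 : k) ∈ ⨅ g : G, eigenspace (Representation.trivial k G k g) ((1 : G →* kˣ) g : k) :=
      (mem_iInf_eigenspace_iff _ _ _).mpr fun g => by simp
    rw [h] at h1
    exact one_ne_zero ((Submodule.mem_bot k).mp h1)
  · intro hψ
    exact iInf_eigenspace_eq_bot_of_scalar_of_ne (Representation.trivial k G k) 1 ψ (fun g a => by simp)
      (Ne.symm hψ)

end Scalar

/-! ## Permutation modules `k[H/G] = Coind_G^H k` and coinduced scalar modules -/

section Permutation

variable {k G H A : Type*} [CommRing k] [Group G] [Group H] (φ : G →* H) [AddCommGroup A] [Module k A]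
  (σ : Representation k G A) (χ : H →* kˣ)

/-- **Anatomy §4 (i): the `χ`-part of the permutation module `k[H/G] = Coind_G^H k` vanishes iff `χ|_G ≠ 1`**
(`k` a domain): `(Ind_{Δ_𝔭}^Δ 𝟙)^{(θ)} = 0` because `θ|_{Δ_𝔭} ≠ 1`. [cite: SerreLinearRepresentations1977, §7.2]
[cite: Washington1997, §6.3] [folklore] -/
theorem iInf_eigenspace_coind_trivial_eq_bot_iff [IsDomain k] :
    (⨅ h : H, eigenspace (coind φ (Representation.trivial k G k) h) (χ h : k)) = ⊥ ↔ χ.comp φ ≠ 1 := by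
  rw [iInf_eigenspace_coind_eq_bot_iff, iInf_eigenspace_trivial_eq_bot_iff]

/-- **Anatomy §4 (ii)(iii): the `χ`-part of `Coind_G^H A` vanishes when `G` acts on `A` through a character `η` with
`η(g₀) − χ(φ g₀)` a unit for some `g₀`** (e.g. `A = μ[p^∞]` with `η = ω|_{Δ_v}` and `χ|_{Δ_v} ≠ ω|_{Δ_v}` as Teichmüller
characters). [cite: SerreLinearRepresentations1977, §7.2] [cite: Washington1997, §6.3] [folklore] -/
theorem iInf_eigenspace_coind_eq_bot_of_scalar_of_isUnit (η : G →* kˣ)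
    (hσ : ∀ (g : G) (a : A), σ g a = (η g : k) • a) (g₀ : G) (hu : IsUnit ((η g₀ : k) - (χ (φ g₀) : k))) :
    (⨅ h : H, eigenspace (coind φ σ h) (χ h : k)) = ⊥ := by
  rw [iInf_eigenspace_coind_eq_bot_iff]
  exact iInf_eigenspace_eq_bot_of_scalar_of_isUnit σ η (χ.comp φ) hσ g₀ hu

/-- The `χ`-part of `Coind_G^H A` for `G` acting on torsion-free `A` through `η ≠ χ|_G` vanishes (domain). [folklore] -/
theorem iInf_eigenspace_coind_eq_bot_of_scalar_of_ne [IsDomain k] [NoZeroSMulDivisors k A] (η : G →* kˣ)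
    (hσ : ∀ (g : G) (a : A), σ g a = (η g : k) • a) (hne : η ≠ χ.comp φ) :
    (⨅ h : H, eigenspace (coind φ σ h) (χ h : k)) = ⊥ := by
  rw [iInf_eigenspace_coind_eq_bot_iff]
  exact iInf_eigenspace_eq_bot_of_scalar_of_ne σ η (χ.comp φ) hσ hne

/-- Conversely the `χ`-part of `Coind_G^H A` is ALL of `A` at `1` when `G` acts through `η = χ|_G`: every `a ∈ A` is
the value at `1` of a `χ`-eigenvector. [folklore] -/
theorem exists_mem_iInf_eigenspace_coind_apply_one_eq_of_scalar (η : G →* kˣ)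
    (hσ : ∀ (g : G) (a : A), σ g a = (η g : k) • a) (heq : χ.comp φ = η) (a : A) :
    ∃ f ∈ ⨅ h : H, eigenspace (coind φ σ h) (χ h : k), (f : H → A) 1 = a := by
  refine exists_mem_iInf_eigenspace_coind_apply_one_eq φ σ χ ?_
  rw [heq, iInf_eigenspace_eq_top_of_scalar σ η hσ]
  exact Submodule.mem_top

end Permutation

end Summit.BirchSwinnertonDyer.BirchSwinnertonDyer.Theorems.PrintCFram.HerbrandEigenspace
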